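import Literature.Geometry.Kaehler.ComplexTorusIntegralDivisorMonomialsIndex
import HarnessLib

/-!
# The ring of minimal classes of a polarised torus of type `(d₁, …, d_g)`: `γ_q ∧ γ_{q'} = C(q+q', q)·(d₁⋯d_{q+q'}/(d₁⋯d_q·d₁⋯d_{q'}))·γ_{q+q'}`,
# the EXACT index of integral hard Lefschetz `θ^{∧j} ∧ (−)` on the Hodge lattices of a general torus, and `∫_X γ_q ∧ γ_{g−q} = (−1)^g C(g, q)·∏ᵢ d_{g−q+i}/dᵢ`

Layer `Literature/Geometry/Kaehler`, namespace `Literature.Geometry.Kaehler.ComplexTorus`; lane `lit-hodgefound` (Track 2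
foundations library), seat p09, generation 36, row g36-#3. THEOREMS ONLY (0 definitions); no named fact, net debt 0. Sequel of g36-#1
`ComplexTorusMinimalClasses` (`θ^{∧q} = (q!·d₁⋯d_q)·γ_q` with `γ_q ∈ Hdg^q(X, ℤ)` primitive; `dim_ℚ B^q(X) = 1 ⟹ Hdg^q(X, ℤ) = ℤγ_q`) and of
g31-#5 `ComplexTorusIntegralHardLefschetz` (`L^j = θ^{∧j} ∧ (−) : Hdgᵖ(X, ℤ) → Hdg^{p+j}(X, ℤ)` injective with finite cokernel, "one `n ≥ 1`").

* Lange 2023, §7.3.1 Lemma 7.3.6 (`⋀ᵖE ∧ ⋀^qE = ⋀^{p+q}E`; the tree's `wedgePow_wedge_wedgePow`), Thm. 7.3.1 / Prop. 7.3.3 (PDF pp. 336–337: general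
  `(X, E)` ⟹ `H^{2p}_Hodge = ℚ·⋀ᵖE`), §7.3.2 (1) (PDF p. 338: hard Lefschetz `L^{g−k}`), §2.5.3 Thm. 2.5.16 and Cor. 2.5.17 (d) "`({D}^g) = d₁ ⋯ d_g g!`"
  (PDF p. 135), §1.7.2 Thm. 1.7.3 / Lemma 1.7.5 (`∫_X ∧^g c₁(L) = (−1)^g g! d₁⋯d_g` in the tree's orientation, A4-26
  `IsRiemannForm.torusIntegral_wedgePow_of_isPolarizationType`), §1.5.1 (types);
* Brown 1982, Ch. V §6 (divided powers: "`x^{(i)}x^{(j)} = (i, j)x^{(i+j)}`, where `(i, j) = (i + j)!/i!j!`"; the tree's `divPowForm_wedge_divPowForm`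
  of seat p35, g26-#2, is the PRINCIPAL case `q!·q'!·C = (q+q')!` of §2 below);
* Benoist–Debarre 2023, §3 proof of Thm. 3.7 (p. 7): "`Hdg^{2k}(X, ℤ)` is generated by `θ^k/k!`", with "the self-intersection formula" of Prop. 3.3.

THE POINT. For a type `d₁ ∣ ⋯ ∣ d_g` put `D_q = d₁⋯d_q`, `N_q = q!·D_q` (the content of `θ^{∧q}`, g36-#1) and `R_{q,q'} = D_{q+q'}/(D_q·D_{q'}) ∈ ℕ`
(§1: `D_q·D_{q'} ∣ D_{q+q'}` since `dᵢ ∣ d_{q+i}`). Dividing Lemma 7.3.6 `θ^{∧q} ∧ θ^{∧q'} = θ^{∧(q+q')}` by the contents gives the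
MULTIPLICATION TABLE OF THE MINIMAL CLASSES (§2)

  **`γ_q ∧ γ_{q'} = C(q+q', q)·R_{q,q'}·γ_{q+q'}`** (`q!·q'!·C(q+q', q) = (q+q')!`; principal: the divided-power law `C(q+q', q)`),

hence (§3) **integral hard Lefschetz on minimal classes: `θ^{∧j} ∧ γ_q = (N_{j+q}/N_q)·γ_{j+q}`**, `N_{j+q}/N_q = ((j+q)!/q!)·d_{q+1}⋯d_{q+j}`, so on a
general polarised torus (`dim_ℚ B^q = dim_ℚ B^{j+q} = 1`, e.g. `Sp ⊆ Hg(X)`) the image of `L^j : Hdg^q(X, ℤ) → Hdg^{j+q}(X, ℤ)` is `ℤ·(N_{j+q}/N_q)γ_{j+q}`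
of index **`[Hdg^{j+q}(X, ℤ) : θ^{∧j} ∧ Hdg^q(X, ℤ)] = ((j+q)!/q!)·d_{q+1}⋯d_{q+j}`** — the "`n ≥ 1`" of g31-#5 named (principal, `2q + j = g`:
`(g−q)!/q!`); and (§4) with `∫_X θ^{∧g} = (−1)^g g!·D_g`, **`∫_X γ_q ∧ γ_{q'} = (−1)^g·C(g, q)·R_{q,q'}`** for `q + q' = g`
(`R_{q,g−q} = ∏_{i<q} d_{g−q+i}/dᵢ`): for `g = 2q` the rank-one middle Hodge lattice `Hdg^q(X, ℤ) = ℤγ_q` of a general torus has discriminant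
`C(2q, q)·∏_{i<q} d_{q+i}/dᵢ` (`2d₂/d₁` on an abelian surface of type `(d₁, d₂)`: `γ₁² = 2d` for type `(1, d)`; `6` on a general p.p. fourfold).

RELATION TO THE TREE (FAIL-DUP check). The principal divided-power law `θ^{[q]} ∧ θ^{[q']} = C(q+q', q)·θ^{[q+q']}` is p35's g26-#2
`divPowForm_wedge_divPowForm` (carrier `divPowForm`); the principal NUMBER `C(g, n)` also appears in p35's g26-#9
`ComplexTorusMinimalClassesIntersectionNumbers` as the KRONECKER pairing `∫_{c^{[⋆n]}} c₁(Θ)^{[n]} = C(g, n)` of a homology divided Pontryagin power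
against a cohomology divided power (type `d`: `e_n(d₁, …, d_g)`, the class `c^{[⋆n]}` not being minimal there). New here: the law for the primitive
generators `γ_q` of EVERY type (the factor `R_{q,q'}`), the exact Lefschetz indices on the Hodge lattices, and the CUP pairing `∫_X γ_q ∧ γ_{q'}` of two
cohomology minimal classes for every type; nothing of g26-#2/#3/#9 is restated.

## Contents (theorems only)

* §1 arithmetic of a type: `prod_castLE_dvd_prod_castLE_of_le` (`D_q ∣ D_k`, `q ≤ k`), `content_dvd_content_of_le` (`N_q ∣ N_k`),
  `prod_castLE_mul_prod_castLE_dvd` (`D_q·D_{q'} ∣ D_{q+q'}`), `content_mul_content_mul_choose_mul_eq` (`N_q·N_{q'}·(C·R) = N_{q+q'}`).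
* §2 **`wedge_eq_choose_mul_smul_of_wedgePow_eq`** (`γ_q ∧ γ_{q'} = C(q+q',q)·R·γ_{q+q'}`, pure form algebra from the three content equations),
  `IsSymplecticEnum.minimalClass_wedge_minimalClass`, principal `…_of_type_one` (`= C(q+q', q)·γ_{q+q'}`).
* §3 **`IsSymplecticEnum.wedgePow_wedge_minimalClass`** (`θ^{∧j} ∧ γ_q = (N_{j+q}/N_q)·γ_{j+q}`), `integralHodgeClassesIn_eq_zmultiples_domDomCongr`,
  **`IsSymplecticEnum.relIndex_map_wedgePow_wedge_integralHodgeClasses`** (exact Lefschetz index on a general torus), `…_of_spGroup_le`,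
  `…_of_type_one` (principal: `(j+q)!/q!`).
* §4 (any presentation of a type-`d` polarised torus) `IsPolarizationType.torusIntegral_minimalClass_top` (`∫_X γ_g = (−1)^g`),
  **`IsPolarizationType.torusIntegral_minimalClass_wedge_minimalClass`** / `IsSymplecticEnum.…` (`∫_X γ_q ∧ γ_{q'} = (−1)^g C(g,q) R`, `q + q' = g`),
  **`IsPolarizationType.torusIntegral_minimalClass_wedge_self`** (`g = 2q`: `C(2q, q)·∏ d_{q+i}/dᵢ`), `…_of_type_one` (principal: `(−1)^g C(g, q)`).
* §5 basis-free forms of the §3 index: `IsPolarizationType.relIndex_map_wedgePow_wedge_integralHodgeClasses`,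
  `IsRiemannForm.relIndex_map_wedgePow_wedge_integralHodgeClasses_of_spGroup_le` (THE type `hη.polarizationType`),
  `IsPrincipalPolarization.relIndex_map_wedgePow_wedge_integralHodgeClasses_of_spGroup_le` (`(j+q)!/q!`).

## References

* [cite: Lange2023AbelianVarietiesComplex, §7.3.1 Lemma 7.3.6, Thm. 7.3.1, Prop. 7.3.3 (PDF pp. 336–338); §7.3.2 (1) (PDF p. 338); §2.5.3 Thm. 2.5.16 and
  Cor. 2.5.17 (d) (PDF p. 135); §1.7.2 Thm. 1.7.3 and Lemma 1.7.5; §1.5.1; §2.1.1]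
* [cite: Brown1982CohomologyGroups, Ch. V §6 (divided powers, (6.5) examples 1 and 4)]
* [cite: BenoistDebarre2023SmoothSubvarietiesJacobians, §3 Prop. 3.3 and proof of Thm. 3.7 (p. 7)]
-/

noncomputable section

open Module Function
open Literature.LinearAlgebra.Alternating

namespace Literature.Geometry.Kaehler.ComplexTorus

section MinimalClassesRing

variable {ι : Type*} [Fintype ι] [DecidableEq ι] {E : Type*} [NormedAddCommGroup E] [NormedSpace ℂ E]
  (Φ : (ι → ℝ) ≃L[ℝ] E) {g : ℕ} {e₀ : Fin g ⊕ Fin g ≃ ι} {η : E [⋀^Fin 2]→L[ℝ] ℝ} {d : Fin g → ℕ}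

/-! ## §1 Arithmetic of a type `d₁ ∣ d₂ ∣ ⋯ ∣ d_g` -/

omit [Fintype ι] [DecidableEq ι] in
/-- **`D_q ∣ D_k` for `q ≤ k`** (`D_q = d₁⋯d_q` is an initial segment of `D_k`). [cite: Lange2023AbelianVarietiesComplex, §1.5.1 (PDF p. 51)] -/
theorem prod_castLE_dvd_prod_castLE_of_le {q k : ℕ} (hqk : q ≤ k) (hk : k ≤ g) :
    ∏ i : Fin q, d (Fin.castLE (hqk.trans hk) i) ∣ ∏ i : Fin k, d (Fin.castLE hk i) := by
  classical
  have h1 : ∏ i : Fin q, d (Fin.castLE (hqk.trans hk) i) =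
      ∏ j ∈ (Finset.univ : Finset (Fin q)).map (Fin.castLEEmb hqk), d (Fin.castLE hk j) := by
    rw [Finset.prod_map]
    refine Finset.prod_congr rfl fun i _ ↦ ?_
    simp [Fin.castLE_castLE]
  rw [h1]
  exact Finset.prod_dvd_prod_of_subset _ _ _ (Finset.subset_univ _)

omit [Fintype ι] [DecidableEq ι] in
/-- **`N_q ∣ N_k` for `q ≤ k`** (`N_q = q!·d₁⋯d_q`, the content of `θ^{∧q}`). [cite: Lange2023AbelianVarietiesComplex, §1.5.1 and §2.5.3 Thm. 2.5.16] -/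
theorem content_dvd_content_of_le {q k : ℕ} (hqk : q ≤ k) (hk : k ≤ g) :
    q.factorial * ∏ i : Fin q, d (Fin.castLE (hqk.trans hk) i) ∣ k.factorial * ∏ i : Fin k, d (Fin.castLE hk i) :=
  Nat.mul_dvd_mul (Nat.factorial_dvd_factorial hqk) (prod_castLE_dvd_prod_castLE_of_le hqk hk)

omit [Fintype ι] [DecidableEq ι] in
/-- `D_{q+q'} = D_q · ∏_{i<q'} d_{q+i}`. [cite: Lange2023AbelianVarietiesComplex, §1.5.1] -/
theorem prod_castLE_add_eq {q q' : ℕ} (hq : q ≤ g) (hqq : q + q' ≤ g) :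
    ∏ i : Fin (q + q'), d (Fin.castLE hqq i) =
      (∏ i : Fin q, d (Fin.castLE hq i)) * ∏ i : Fin q', d (Fin.castLE hqq (Fin.natAdd q i)) := by
  rw [Fin.prod_univ_add]
  rfl

omit [Fintype ι] [DecidableEq ι] in
/-- **`D_{q'} ∣ ∏_{i<q'} d_{q+i}`** along the chain (`dᵢ ∣ d_{q+i}`). [cite: Lange2023AbelianVarietiesComplex, §1.5.1 (PDF p. 51)] -/
theorem prod_castLE_dvd_prod_castLE_natAdd (hd : ∀ i j : Fin g, i ≤ j → d i ∣ d j) {q q' : ℕ} (hq' : q' ≤ g) (hqq : q + q' ≤ g) :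
    ∏ i : Fin q', d (Fin.castLE hq' i) ∣ ∏ i : Fin q', d (Fin.castLE hqq (Fin.natAdd q i)) :=
  Finset.prod_dvd_prod_of_dvd _ _ fun i _ ↦ hd _ _ (by
    rw [Fin.le_def, Fin.val_castLE, Fin.val_castLE, Fin.val_natAdd]
    exact Nat.le_add_left _ _)

omit [Fintype ι] [DecidableEq ι] in
/-- **`D_q · D_{q'} ∣ D_{q+q'}`**: the ratio `R_{q,q'} = D_{q+q'}/(D_q D_{q'})` is an integer. [cite: Lange2023AbelianVarietiesComplex, §1.5.1 (PDF p. 51)] -/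
theorem prod_castLE_mul_prod_castLE_dvd (hd : ∀ i j : Fin g, i ≤ j → d i ∣ d j) {q q' : ℕ} (hq : q ≤ g) (hq' : q' ≤ g)
    (hqq : q + q' ≤ g) :
    (∏ i : Fin q, d (Fin.castLE hq i)) * ∏ i : Fin q', d (Fin.castLE hq' i) ∣ ∏ i : Fin (q + q'), d (Fin.castLE hqq i) := by
  rw [prod_castLE_add_eq hq hqq]
  exact Nat.mul_dvd_mul_left _ (prod_castLE_dvd_prod_castLE_natAdd hd hq' hqq)

omit [Fintype ι] [DecidableEq ι] in
/-- **`N_q · N_{q'} · (C(q+q', q) · R_{q,q'}) = N_{q+q'}`** (`q!·q'!·C(q+q',q) = (q+q')!` and `D_q·D_{q'}·R = D_{q+q'}`).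
[cite: Lange2023AbelianVarietiesComplex, §1.5.1] [cite: Brown1982CohomologyGroups, Ch. V §6 ((i, j) = (i+j)!/i!j!)] -/
theorem content_mul_content_mul_choose_mul_eq (hd : ∀ i j : Fin g, i ≤ j → d i ∣ d j) {q q' : ℕ} (hq : q ≤ g) (hq' : q' ≤ g)
    (hqq : q + q' ≤ g) :
    (q.factorial * ∏ i : Fin q, d (Fin.castLE hq i)) * (q'.factorial * ∏ i : Fin q', d (Fin.castLE hq' i)) *
        ((q + q').choose q * ((∏ i : Fin (q + q'), d (Fin.castLE hqq i)) /
          ((∏ i : Fin q, d (Fin.castLE hq i)) * ∏ i : Fin q', d (Fin.castLE hq' i)))) =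
      (q + q').factorial * ∏ i : Fin (q + q'), d (Fin.castLE hqq i) := by
  have hR := Nat.div_mul_cancel (prod_castLE_mul_prod_castLE_dvd hd hq hq' hqq)
  have hC : (q + q').choose q * q.factorial * q'.factorial = (q + q').factorial := by
    have h0 := Nat.add_choose_mul_factorial_mul_factorial q' q
    rw [add_comm q' q] at h0
    rw [mul_right_comm]
    exact h0
  calc (q.factorial * ∏ i : Fin q, d (Fin.castLE hq i)) * (q'.factorial * ∏ i : Fin q', d (Fin.castLE hq' i)) *
        ((q + q').choose q * ((∏ i : Fin (q + q'), d (Fin.castLE hqq i)) /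
          ((∏ i : Fin q, d (Fin.castLE hq i)) * ∏ i : Fin q', d (Fin.castLE hq' i))))
      = ((q + q').choose q * q.factorial * q'.factorial) *
          ((∏ i : Fin (q + q'), d (Fin.castLE hqq i)) /
            ((∏ i : Fin q, d (Fin.castLE hq i)) * ∏ i : Fin q', d (Fin.castLE hq' i)) *
            ((∏ i : Fin q, d (Fin.castLE hq i)) * ∏ i : Fin q', d (Fin.castLE hq' i))) := by ring
    _ = (q + q').factorial * ∏ i : Fin (q + q'), d (Fin.castLE hqq i) := by rw [hC, hR]

/-! ## §2 The multiplication table of the minimal classes: `γ_q ∧ γ_{q'} = C(q+q', q)·R_{q,q'}·γ_{q+q'}` -/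

omit [Fintype ι] [DecidableEq ι] in
/-- **`γ_q ∧ γ_{q'} = C(q+q', q)·R_{q,q'}·γ_{q+q'}`** (`R_{q,q'} = D_{q+q'}/(D_q D_{q'})`, transported along `2q + 2q' = 2(q+q')`), for any three forms
with `θ^{∧q} = N_q·γ_q`, `θ^{∧q'} = N_{q'}·γ_{q'}`, `θ^{∧(q+q')} = N_{q+q'}·γ_{q+q'}` and a type `d₁ ∣ ⋯ ∣ d_g` with `dᵢ > 0`: Lemma 7.3.6
`θ^{∧q} ∧ θ^{∧q'} = θ^{∧(q+q')}` divided by the contents (cancel `N_q N_{q'} ≠ 0`). Principal type: the divided-power law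
`θ^{[q]} ∧ θ^{[q']} = C(q+q', q)·θ^{[q+q']}` (the tree's `divPowForm_wedge_divPowForm`, seat p35).
[cite: Lange2023AbelianVarietiesComplex, §7.3.1 Lemma 7.3.6 (PDF p. 338) and §2.5.3 Thm. 2.5.16] [cite: Brown1982CohomologyGroups, Ch. V §6] -/
theorem wedge_eq_choose_mul_smul_of_wedgePow_eq (hd : ∀ i j : Fin g, i ≤ j → d i ∣ d j) (hpos : ∀ i, 0 < d i) {q q' : ℕ}
    (hq : q ≤ g) (hq' : q' ≤ g) (hqq : q + q' ≤ g) {θ : E [⋀^Fin 2]→L[ℝ] ℂ} {γ : E [⋀^Fin (2 * q)]→L[ℝ] ℂ}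
    {γ' : E [⋀^Fin (2 * q')]→L[ℝ] ℂ} {γ'' : E [⋀^Fin (2 * (q + q'))]→L[ℝ] ℂ}
    (hγ : wedgePow θ q = ((q.factorial * ∏ i : Fin q, d (Fin.castLE hq i) : ℕ) : ℂ) • γ)
    (hγ' : wedgePow θ q' = ((q'.factorial * ∏ i : Fin q', d (Fin.castLE hq' i) : ℕ) : ℂ) • γ')
    (hγ'' : wedgePow θ (q + q') = (((q + q').factorial * ∏ i : Fin (q + q'), d (Fin.castLE hqq i) : ℕ) : ℂ) • γ'') :
    γ.wedge γ' = (((q + q').choose q * ((∏ i : Fin (q + q'), d (Fin.castLE hqq i)) /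
        ((∏ i : Fin q, d (Fin.castLE hq i)) * ∏ i : Fin q', d (Fin.castLE hq' i))) : ℕ) : ℂ) •
      γ''.domDomCongr (finCongr (Nat.left_distrib 2 q q')) := by
  have hN : ∀ {k : ℕ} (hk : k ≤ g), ((k.factorial * ∏ i : Fin k, d (Fin.castLE hk i) : ℕ) : ℂ) ≠ 0 := fun hk ↦ by
    exact_mod_cast Nat.mul_ne_zero (Nat.factorial_ne_zero _) (Finset.prod_ne_zero_iff.2 fun i _ ↦ (hpos _).ne')
  have hc : ((q.factorial * ∏ i : Fin q, d (Fin.castLE hq i) : ℕ) : ℂ) *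
      ((q'.factorial * ∏ i : Fin q', d (Fin.castLE hq' i) : ℕ) : ℂ) ≠ 0 := mul_ne_zero (hN hq) (hN hq')
  refine smul_right_injective _ hc ?_
  change (((q.factorial * ∏ i : Fin q, d (Fin.castLE hq i) : ℕ) : ℂ) *
      ((q'.factorial * ∏ i : Fin q', d (Fin.castLE hq' i) : ℕ) : ℂ)) • γ.wedge γ' = _ • _
  have h1 : (((q.factorial * ∏ i : Fin q, d (Fin.castLE hq i) : ℕ) : ℂ) *
      ((q'.factorial * ∏ i : Fin q', d (Fin.castLE hq' i) : ℕ) : ℂ)) • γ.wedge γ' =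
      (wedgePow θ q).wedge (wedgePow θ q') := by
    rw [hγ, hγ', wedge_smul_left_complex, wedge_smul_right_complex, smul_smul]
  rw [h1, wedgePow_wedge_wedgePow, hγ'', smul_smul]
  change (((q + q').factorial * ∏ i : Fin (q + q'), d (Fin.castLE hqq i) : ℕ) : ℂ) •
      γ''.domDomCongr (finCongr (Nat.left_distrib 2 q q')) = _
  congr 1
  rw [← Nat.cast_mul, ← Nat.cast_mul, content_mul_content_mul_choose_mul_eq hd hq hq' hqq]

/-- **The multiplication table of the minimal classes of a polarised torus of type `(d₁, …, d_g)`: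
`γ_q ∧ γ_{q'} = C(q+q', q)·(d₁⋯d_{q+q'}/(d₁⋯d_q · d₁⋯d_{q'}))·γ_{q+q'}`** (`q + q' ≤ g`; `γ_k = θ^{∧k}/(k!·d₁⋯d_k)` the minimal classes of g36-#1,
symplectic presentation). [cite: Lange2023AbelianVarietiesComplex, §7.3.1 Lemma 7.3.6 (PDF p. 338), §2.5.3 Thm. 2.5.16, §1.5.1] [cite: Brown1982CohomologyGroups, Ch. V §6] -/
theorem IsSymplecticEnum.minimalClass_wedge_minimalClass (h : IsSymplecticEnum Φ e₀ η d) (hη : IsRiemannForm Φ η) {q q' : ℕ}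
    (hq : q ≤ g) (hq' : q' ≤ g) (hqq : q + q' ≤ g) {γ : E [⋀^Fin (2 * q)]→L[ℝ] ℂ} {γ' : E [⋀^Fin (2 * q')]→L[ℝ] ℂ}
    {γ'' : E [⋀^Fin (2 * (q + q'))]→L[ℝ] ℂ}
    (hγ : wedgePow (ofRealForm η) q = ((q.factorial * ∏ i : Fin q, d (Fin.castLE hq i) : ℕ) : ℂ) • γ)
    (hγ' : wedgePow (ofRealForm η) q' = ((q'.factorial * ∏ i : Fin q', d (Fin.castLE hq' i) : ℕ) : ℂ) • γ')
    (hγ'' : wedgePow (ofRealForm η) (q + q') = (((q + q').factorial * ∏ i : Fin (q + q'), d (Fin.castLE hqq i) : ℕ) : ℂ) • γ'') :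
    γ.wedge γ' = (((q + q').choose q * ((∏ i : Fin (q + q'), d (Fin.castLE hqq i)) /
        ((∏ i : Fin q, d (Fin.castLE hq i)) * ∏ i : Fin q', d (Fin.castLE hq' i))) : ℕ) : ℂ) •
      γ''.domDomCongr (finCongr (Nat.left_distrib 2 q q')) :=
  wedge_eq_choose_mul_smul_of_wedgePow_eq hd' (h.pos hη) hq hq' hqq hγ hγ' hγ''
  where hd' : ∀ i j : Fin g, i ≤ j → d i ∣ d j := h.dvd

/-- **Principal type: `γ_q ∧ γ_{q'} = C(q+q', q)·γ_{q+q'}`** — the divided-power law of the minimal classes `θ^{∧k}/k!` of a principally polarised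
torus ("`x^{(i)}x^{(j)} = (i, j)x^{(i+j)}`"). [cite: Brown1982CohomologyGroups, Ch. V §6] [cite: Lange2023AbelianVarietiesComplex, §7.3.1 Lemma 7.3.6, §2.1.1] -/
theorem IsSymplecticEnum.minimalClass_wedge_minimalClass_of_type_one (h : IsSymplecticEnum Φ e₀ η d) (hη : IsRiemannForm Φ η)
    (h1 : ∀ i, d i = 1) {q q' : ℕ} (hq : q ≤ g) (hq' : q' ≤ g) (hqq : q + q' ≤ g) {γ : E [⋀^Fin (2 * q)]→L[ℝ] ℂ}
    {γ' : E [⋀^Fin (2 * q')]→L[ℝ] ℂ} {γ'' : E [⋀^Fin (2 * (q + q'))]→L[ℝ] ℂ}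
    (hγ : wedgePow (ofRealForm η) q = (q.factorial : ℂ) • γ) (hγ' : wedgePow (ofRealForm η) q' = (q'.factorial : ℂ) • γ')
    (hγ'' : wedgePow (ofRealForm η) (q + q') = ((q + q').factorial : ℂ) • γ'') :
    γ.wedge γ' = ((q + q').choose q : ℂ) • γ''.domDomCongr (finCongr (Nat.left_distrib 2 q q')) := by
  have hN : ∀ {k : ℕ} (hk : k ≤ g), ((k.factorial * ∏ i : Fin k, d (Fin.castLE hk i) : ℕ) : ℂ) = (k.factorial : ℂ) := fun hk ↦ by
    simp [h1]
  have key := h.minimalClass_wedge_minimalClass Φ hη hq hq' hqq (by rw [hN, hγ]) (by rw [hN, hγ']) (by rw [hN, hγ''])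
  rw [key]
  congr 1
  simp [h1]

/-! ## §3 Integral hard Lefschetz on the minimal classes, EXACTLY: `θ^{∧j} ∧ γ_q = (N_{j+q}/N_q) · γ_{j+q}` -/

omit [Fintype ι] [DecidableEq ι] in
/-- **`θ^{∧j} ∧ γ_q = (N_{j+q}/N_q) · γ_{j+q}`**, `N_k = k!·d₁⋯d_k`, `N_{j+q}/N_q = ((j+q)!/q!)·d_{q+1}⋯d_{q+j}` (transported along `2j + 2q = 2(j+q)`), from
the content equations `θ^{∧q} = N_q·γ_q`, `θ^{∧(j+q)} = N_{j+q}·γ_{j+q}` (cancel `N_q ≠ 0` in `N_q·(θ^{∧j} ∧ γ_q) = θ^{∧j} ∧ θ^{∧q} = θ^{∧(j+q)}`; `N_q ∣ N_{j+q}`).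
[cite: Lange2023AbelianVarietiesComplex, §7.3.1 Lemma 7.3.6 and §7.3.2 (1) (PDF p. 338), §2.5.3 Thm. 2.5.16] -/
theorem wedgePow_wedge_eq_quot_smul_of_wedgePow_eq (hpos : ∀ i, 0 < d i) {j q : ℕ} (hq : q ≤ g) (hjq : j + q ≤ g)
    {θ : E [⋀^Fin 2]→L[ℝ] ℂ} {γ : E [⋀^Fin (2 * q)]→L[ℝ] ℂ} {γ'' : E [⋀^Fin (2 * (j + q))]→L[ℝ] ℂ}
    (hγ : wedgePow θ q = ((q.factorial * ∏ i : Fin q, d (Fin.castLE hq i) : ℕ) : ℂ) • γ)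
    (hγ'' : wedgePow θ (j + q) = (((j + q).factorial * ∏ i : Fin (j + q), d (Fin.castLE hjq i) : ℕ) : ℂ) • γ'') :
    (wedgePow θ j).wedge γ = ((((j + q).factorial * ∏ i : Fin (j + q), d (Fin.castLE hjq i)) /
        (q.factorial * ∏ i : Fin q, d (Fin.castLE hq i)) : ℕ) : ℂ) • γ''.domDomCongr (finCongr (Nat.left_distrib 2 j q)) := by
  have hN : ((q.factorial * ∏ i : Fin q, d (Fin.castLE hq i) : ℕ) : ℂ) ≠ 0 := by
    exact_mod_cast Nat.mul_ne_zero (Nat.factorial_ne_zero _) (Finset.prod_ne_zero_iff.2 fun i _ ↦ (hpos _).ne')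
  have hdvd : q.factorial * ∏ i : Fin q, d (Fin.castLE hq i) ∣ (j + q).factorial * ∏ i : Fin (j + q), d (Fin.castLE hjq i) :=
    content_dvd_content_of_le (Nat.le_add_left q j) hjq
  refine smul_right_injective _ hN ?_
  change ((q.factorial * ∏ i : Fin q, d (Fin.castLE hq i) : ℕ) : ℂ) • (wedgePow θ j).wedge γ = _ • _
  rw [← wedge_smul_right_complex, ← hγ, wedgePow_wedge_wedgePow, hγ'', smul_smul, ← Nat.cast_mul, Nat.mul_div_cancel' hdvd]
  rfl

/-- **`θ^{∧j} ∧ γ_q = ((j+q)!/q!)·d_{q+1}⋯d_{q+j} · γ_{j+q}` on a polarised torus of type `(d₁, …, d_g)`** (symplectic presentation, `j + q ≤ g`):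
the Lefschetz operator `L^j` carries the minimal class of codimension `q` to `N_{j+q}/N_q` times the minimal class of codimension `j + q` — on a
principally polarised torus `L^j(θ^{[q]}) = ((j+q)!/q!)·θ^{[j+q]}`. [cite: Lange2023AbelianVarietiesComplex, §7.3.2 (1) (PDF p. 338), §7.3.1 Lemma 7.3.6, §2.5.3 Thm. 2.5.16] -/
theorem IsSymplecticEnum.wedgePow_wedge_minimalClass (h : IsSymplecticEnum Φ e₀ η d) (hη : IsRiemannForm Φ η) {j q : ℕ} (hq : q ≤ g)
    (hjq : j + q ≤ g) {γ : E [⋀^Fin (2 * q)]→L[ℝ] ℂ} {γ'' : E [⋀^Fin (2 * (j + q))]→L[ℝ] ℂ}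
    (hγ : wedgePow (ofRealForm η) q = ((q.factorial * ∏ i : Fin q, d (Fin.castLE hq i) : ℕ) : ℂ) • γ)
    (hγ'' : wedgePow (ofRealForm η) (j + q) = (((j + q).factorial * ∏ i : Fin (j + q), d (Fin.castLE hjq i) : ℕ) : ℂ) • γ'') :
    (wedgePow (ofRealForm η) j).wedge γ = ((((j + q).factorial * ∏ i : Fin (j + q), d (Fin.castLE hjq i)) /
        (q.factorial * ∏ i : Fin q, d (Fin.castLE hq i)) : ℕ) : ℂ) • γ''.domDomCongr (finCongr (Nat.left_distrib 2 j q)) :=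
  wedgePow_wedge_eq_quot_smul_of_wedgePow_eq (h.pos hη) hq hjq hγ hγ''

omit [Fintype ι] [DecidableEq ι] in
/-- `H^N(X, ℂ)` is torsion-free over `ℤ`: `a·x = b·x` with `x ≠ 0` forces `a = b`. [folklore] -/
private theorem int_smul_left_cancel₃ {N : ℕ} {x : E [⋀^Fin N]→L[ℝ] ℂ} (hx : x ≠ 0) {a b : ℤ} (h : a • x = b • x) : a = b := by
  have h1 : ((a : ℂ)) • x = ((b : ℂ)) • x := by
    rw [Int.cast_smul_eq_zsmul ℂ a x, Int.cast_smul_eq_zsmul ℂ b x, h]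
  exact Int.cast_injective (smul_left_injective ℂ hx h1)

omit [Fintype ι] [DecidableEq ι] in
/-- `[ℤx : ℤ(M·x)] = M` for a non-zero class `x ∈ H^N(X, ℂ)` (file-local form of g36-#2's lemma). [folklore] -/
private theorem relIndex_zmultiples_natCast_smul₃ {N : ℕ} {x : E [⋀^Fin N]→L[ℝ] ℂ} (hx : x ≠ 0) (M : ℕ) :
    (AddSubgroup.zmultiples ((M : ℂ) • x)).relIndex (AddSubgroup.zmultiples x) = M := by
  set K : AddSubgroup (E [⋀^Fin N]→L[ℝ] ℂ) := AddSubgroup.zmultiples x with hK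
  let f : ℤ →+ K := zmultiplesHom K ⟨x, AddSubgroup.mem_zmultiples x⟩
  have hfn : ∀ n : ℤ, ((f n : K) : E [⋀^Fin N]→L[ℝ] ℂ) = n • x := fun n ↦ by
    simp [f]
  have hf : Surjective f := by
    rintro ⟨y, hy⟩
    obtain ⟨n, rfl⟩ := AddSubgroup.mem_zmultiples_iff.1 hy
    exact ⟨n, Subtype.ext (hfn n)⟩
  rw [AddSubgroup.relIndex, ← AddSubgroup.index_comap_of_surjective _ hf]
  have hcomap : ((AddSubgroup.zmultiples ((M : ℂ) • x)).addSubgroupOf K).comap f = AddSubgroup.zmultiples (M : ℤ) := by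
    ext n
    rw [AddSubgroup.mem_comap, AddSubgroup.mem_addSubgroupOf, hfn, AddSubgroup.mem_zmultiples_iff, Int.mem_zmultiples_iff]
    constructor
    · rintro ⟨k, hk⟩
      rw [Nat.cast_smul_eq_nsmul ℂ M x, ← natCast_zsmul x M, smul_smul] at hk
      exact ⟨k, by rw [← int_smul_left_cancel₃ hx hk, mul_comm]⟩
    · rintro ⟨c, rfl⟩
      exact ⟨c, by rw [Nat.cast_smul_eq_nsmul ℂ M x, ← natCast_zsmul x M, smul_smul, mul_comm]⟩
  rw [hcomap, Int.index_zmultiples, Int.natAbs_natCast]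

omit [Fintype ι] [DecidableEq ι] in
/-- Transport of a rank-one integral Hodge lattice along an equation of degrees: `Hdg^{n,p} = ℤγ ⟹ Hdg^{n',p} = ℤ·γ.domDomCongr`.
[cite: Lange2023AbelianVarietiesComplex, §7.2.2] -/
theorem integralHodgeClassesIn_eq_zmultiples_domDomCongr {Φ : (ι → ℝ) ≃L[ℝ] E} {n n' : ℕ} (hn : n = n') (p : ℕ)
    {γ : E [⋀^Fin n]→L[ℝ] ℂ} (hZ : integralHodgeClassesIn Φ n p = AddSubgroup.zmultiples γ) :
    integralHodgeClassesIn Φ n' p = AddSubgroup.zmultiples (γ.domDomCongr (finCongr hn)) := by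
  subst hn
  rw [finCongr_refl, ContinuousAlternatingMap.domDomCongr_refl]
  exact hZ

omit [Fintype ι] [DecidableEq ι] in
/-- Reindexing does not kill a non-zero form. [folklore] -/
private theorem domDomCongr_ne_zero {n n' : ℕ} (σ : Fin n ≃ Fin n') {γ : E [⋀^Fin n]→L[ℝ] ℂ} (hγ : γ ≠ 0) : γ.domDomCongr σ ≠ 0 := by
  intro h0
  apply hγ
  rw [← ContinuousAlternatingMap.domDomCongr_refl γ, ← Equiv.self_trans_symm σ, ContinuousAlternatingMap.domDomCongr_trans, h0,
    ContinuousAlternatingMap.domDomCongr_zero]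

/-- **THE EXACT INDEX OF INTEGRAL HARD LEFSCHETZ ON THE HODGE LATTICES OF A GENERAL POLARISED TORUS:
`[Hdg^{j+q}(X, ℤ) : θ^{∧j} ∧ Hdg^q(X, ℤ)] = N_{j+q}/N_q = ((j+q)!/q!)·d_{q+1}⋯d_{q+j}`** (type `(d₁, …, d_g)`, `j + q ≤ g`,
`dim_ℚ B^q(X) = dim_ℚ B^{j+q}(X) = 1`): `Hdg^q(X, ℤ) = ℤγ_q`, `Hdg^{j+q}(X, ℤ) = ℤγ_{j+q}` (g36-#1 §7) and `θ^{∧j} ∧ γ_q = (N_{j+q}/N_q)·γ_{j+q}` —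
the "`n ≥ 1`" of g31-#5's `exists_pos_forall_integralHodgeClassesIn_nsmul_eq_wedgePow_wedge` NAMED (for `2q + j = g`: `((g−q)!/q!)·d_{q+1}⋯d_{g−q}`).
[cite: Lange2023AbelianVarietiesComplex, §7.3.2 (1) (PDF p. 338), §7.3.1 Thm. 7.3.1 and Lemma 7.3.6, §2.5.3 Thm. 2.5.16] [cite: BenoistDebarre2023SmoothSubvarietiesJacobians, §3 proof of Thm. 3.7 (p. 7)] -/
theorem IsSymplecticEnum.relIndex_map_wedgePow_wedge_integralHodgeClasses (h : IsSymplecticEnum Φ e₀ η d) (hη : IsRiemannForm Φ η)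
    {j q : ℕ} (hq : q ≤ g) (hjq : j + q ≤ g) (hBq : finrank ℚ (hodgeClasses Φ q) = 1) (hBjq : finrank ℚ (hodgeClasses Φ (j + q)) = 1) :
    ((integralHodgeClasses Φ q).map (AddMonoidHom.mk'
        (fun x : E [⋀^Fin (2 * q)]→L[ℝ] ℂ ↦ (wedgePow (ofRealForm η) j).wedge x)
        (ContinuousAlternatingMap.wedge_add_right _))).relIndex (integralHodgeClassesIn Φ (2 * j + 2 * q) (j + q)) =
      ((j + q).factorial * ∏ i : Fin (j + q), d (Fin.castLE hjq i)) / (q.factorial * ∏ i : Fin q, d (Fin.castLE hq i)) := by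
  obtain ⟨γ, hγZ, hγ⟩ := h.exists_mem_integralForms_wedgePow_eq_content_smul Φ hq
  obtain ⟨γ'', hγ''Z, hγ''⟩ := h.exists_mem_integralForms_wedgePow_eq_content_smul Φ hjq
  have hL := h.wedgePow_wedge_minimalClass Φ hη hq hjq hγ hγ''
  have hZq := h.integralHodgeClasses_eq_zmultiples_of_finrank_eq_one Φ hη hq hγZ hγ hBq
  have hZjq : integralHodgeClassesIn Φ (2 * j + 2 * q) (j + q) =
      AddSubgroup.zmultiples (γ''.domDomCongr (finCongr (Nat.left_distrib 2 j q))) :=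
    integralHodgeClassesIn_eq_zmultiples_domDomCongr (Nat.left_distrib 2 j q) (j + q)
      (h.integralHodgeClasses_eq_zmultiples_of_finrank_eq_one Φ hη hjq hγ''Z hγ'' hBjq)
  rw [hZq, AddMonoidHom.map_zmultiples, hZjq, AddMonoidHom.mk'_apply, hL]
  exact relIndex_zmultiples_natCast_smul₃ (domDomCongr_ne_zero _ (h.ne_zero_of_wedgePow_eq_content_smul Φ hη hjq hγ'')) _

/-- **General polarised torus (`Sp ⊆ Hg(X)`): `[Hdg^{j+q}(X, ℤ) : θ^{∧j} ∧ Hdg^q(X, ℤ)] = ((j+q)!/q!)·d_{q+1}⋯d_{q+j}`** for all `j + q ≤ g`.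
[cite: Lange2023AbelianVarietiesComplex, §7.3.2 (1) (PDF p. 338), §7.3.1 Prop. 7.3.3 and Thm. 7.3.1] [cite: BenoistDebarre2023SmoothSubvarietiesJacobians, §3 proof of Thm. 3.7 (p. 7)] -/
theorem IsSymplecticEnum.relIndex_map_wedgePow_wedge_integralHodgeClasses_of_spGroup_le (h : IsSymplecticEnum Φ e₀ η d)
    (hη : IsRiemannForm Φ η) (hHg : spGroup Φ η ≤ hodgeGroup Φ) {j q : ℕ} (hq : q ≤ g) (hjq : j + q ≤ g) :
    ((integralHodgeClasses Φ q).map (AddMonoidHom.mk'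
        (fun x : E [⋀^Fin (2 * q)]→L[ℝ] ℂ ↦ (wedgePow (ofRealForm η) j).wedge x)
        (ContinuousAlternatingMap.wedge_add_right _))).relIndex (integralHodgeClassesIn Φ (2 * j + 2 * q) (j + q)) =
      ((j + q).factorial * ∏ i : Fin (j + q), d (Fin.castLE hjq i)) / (q.factorial * ∏ i : Fin q, d (Fin.castLE hq i)) := by
  haveI := finiteDimensional_real Φ (ilvEnum e₀)
  haveI : FiniteDimensional ℂ E := Module.Finite.of_restrictScalars_finite ℝ ℂ E
  have hg : finrank ℂ E = g := finrank_eq_of_finTwoMulEquiv Φ (ilvEnum e₀)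
  exact h.relIndex_map_wedgePow_wedge_integralHodgeClasses Φ hη hq hjq
    (hη.finrank_hodgeClasses_eq_one_of_spGroup_le hHg (hg.symm ▸ hq))
    (hη.finrank_hodgeClasses_eq_one_of_spGroup_le hHg (hg.symm ▸ hjq))

/-- **Principal type: `[Hdg^{j+q}(X, ℤ) : θ^{∧j} ∧ Hdg^q(X, ℤ)] = (j+q)!/q!`** on a general p.p. torus (`dim_ℚ B^q = dim_ℚ B^{j+q} = 1`) — for the hard
Lefschetz degree `2q + j = g`: `(g−q)!/q!`, e.g. `(g−1)!` on `Hdg¹ → Hdg^{g−1}` (cf. g35-#1: `((g−1)!)^{2g}` on ALL of `H¹(X, ℤ) → H^{2g−1}(X, ℤ)`).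
[cite: BenoistDebarre2023SmoothSubvarietiesJacobians, §3 proof of Thm. 3.7 (p. 7)] [cite: Lange2023AbelianVarietiesComplex, §7.3.2 (1) (PDF p. 338), §2.1.1] -/
theorem IsSymplecticEnum.relIndex_map_wedgePow_wedge_integralHodgeClasses_of_type_one (h : IsSymplecticEnum Φ e₀ η d)
    (hη : IsRiemannForm Φ η) (h1 : ∀ i, d i = 1) {j q : ℕ} (hq : q ≤ g) (hjq : j + q ≤ g) (hBq : finrank ℚ (hodgeClasses Φ q) = 1)
    (hBjq : finrank ℚ (hodgeClasses Φ (j + q)) = 1) :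
    ((integralHodgeClasses Φ q).map (AddMonoidHom.mk'
        (fun x : E [⋀^Fin (2 * q)]→L[ℝ] ℂ ↦ (wedgePow (ofRealForm η) j).wedge x)
        (ContinuousAlternatingMap.wedge_add_right _))).relIndex (integralHodgeClassesIn Φ (2 * j + 2 * q) (j + q)) =
      (j + q).factorial / q.factorial := by
  rw [h.relIndex_map_wedgePow_wedge_integralHodgeClasses Φ hη hq hjq hBq hBjq]
  simp [h1]

/-! ## §4 The cup pairing of the minimal classes: `∫_X γ_q ∧ γ_{q'} = (−1)^g·C(g, q)·R_{q,q'}` (`q + q' = g`) -/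

/-- **`∫_X γ_g = (−1)^g`** for the top minimal class (`θ^{∧g} = (g!·d₁⋯d_g)·γ_g` and `∫_X θ^{∧g} = (−1)^g g!·d₁⋯d_g`, A4-26), any presentation of a
polarised torus of type `(d₁, …, d_g)` and any enumeration `e` of the lattice basis. [cite: Lange2023AbelianVarietiesComplex, §1.7.2 Thm. 1.7.3 / Lemma 1.7.5 and §2.5.3 Cor. 2.5.17 (d) (PDF p. 135)] -/
theorem IsPolarizationType.torusIntegral_minimalClass_top {Φ : (ι → ℝ) ≃L[ℝ] E} (hd : IsPolarizationType Φ η d) (hη : IsRiemannForm Φ η)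
    (e : Fin (2 * g) ≃ ι) {γ : E [⋀^Fin (2 * g)]→L[ℝ] ℂ}
    (hγ : wedgePow (ofRealForm η) g = ((g.factorial * ∏ i : Fin g, d (Fin.castLE le_rfl i) : ℕ) : ℂ) • γ) :
    torusIntegral Φ e γ = (-1) ^ g := by
  have hN : ((g.factorial * ∏ i : Fin g, d (Fin.castLE le_rfl i) : ℕ) : ℂ) ≠ 0 := by
    exact_mod_cast Nat.mul_ne_zero (Nat.factorial_ne_zero _) (Finset.prod_ne_zero_iff.2 fun i _ ↦ (hd.pos hη _).ne')
  have h1 := hη.torusIntegral_wedgePow_of_isPolarizationType Φ hd e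
  rw [hγ, torusIntegral_smul] at h1
  refine (mul_right_inj' hN).1 (h1.trans ?_)
  push_cast
  have hc : (fun i : Fin g ↦ (d (Fin.castLE le_rfl i) : ℂ)) = fun i ↦ (d i : ℂ) := funext fun i ↦ rfl
  rw [hc]
  ring

omit [Fintype ι] in
/-- `∫_X` of a top form reindexed along `Fin a = Fin b` (a private copy of `torusIntegral_domDomCongr_finCongr` of
`ComplexTorusFourierInversion`, outside this file's import cone). [cite: Lange2023AbelianVarietiesComplex, §1.7.2 (PDF p. 73)] -/
private theorem torusIntegral_domDomCongr_finCongr₃₆ {Φ : (ι → ℝ) ≃L[ℝ] E} {a b : ℕ} (hab : a = b) (e : Fin b ≃ ι)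
    (θ : E [⋀^Fin a]→L[ℝ] ℂ) :
    torusIntegral Φ e (θ.domDomCongr (finCongr hab)) = torusIntegral Φ ((finCongr hab).trans e) θ := by
  subst hab
  rw [finCongr_refl, Equiv.refl_trans, ContinuousAlternatingMap.domDomCongr_refl]

/-- **`∫_X γ_q ∧ γ_{q'} = (−1)^g · C(g, q) · (d₁⋯d_g/(d₁⋯d_q·d₁⋯d_{q'}))` for `q + q' = g`** — the cup pairing of complementary minimal classes on any
presentation of a polarised torus of type `(d₁, …, d_g)` (`γ_q ∧ γ_{q'} = C·R·γ_g`, §2, and `∫_X γ_g = (−1)^g`); `R_{q,g−q} = ∏_{i<q} d_{g−q+i}/dᵢ ∈ ℕ`.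
[cite: Lange2023AbelianVarietiesComplex, §7.3.1 Lemma 7.3.6, §1.7.2 Thm. 1.7.3, §2.5.3 Cor. 2.5.17 (d) (PDF p. 135)] [cite: BenoistDebarre2023SmoothSubvarietiesJacobians, §3 Prop. 3.3 (self-intersection formula)] -/
theorem IsPolarizationType.torusIntegral_minimalClass_wedge_minimalClass {Φ : (ι → ℝ) ≃L[ℝ] E} (hd : IsPolarizationType Φ η d)
    (hη : IsRiemannForm Φ η) {q q' : ℕ} (hq : q ≤ g) (hq' : q' ≤ g) (hqq : q + q' = g) (e : Fin (2 * q + 2 * q') ≃ ι)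
    {γ : E [⋀^Fin (2 * q)]→L[ℝ] ℂ} {γ' : E [⋀^Fin (2 * q')]→L[ℝ] ℂ}
    (hγ : wedgePow (ofRealForm η) q = ((q.factorial * ∏ i : Fin q, d (Fin.castLE hq i) : ℕ) : ℂ) • γ)
    (hγ' : wedgePow (ofRealForm η) q' = ((q'.factorial * ∏ i : Fin q', d (Fin.castLE hq' i) : ℕ) : ℂ) • γ') :
    torusIntegral Φ e (γ.wedge γ') = (-1) ^ g * ((g.choose q * ((∏ i, d i) /
        ((∏ i : Fin q, d (Fin.castLE hq i)) * ∏ i : Fin q', d (Fin.castLE hq' i))) : ℕ) : ℂ) := by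
  subst hqq
  obtain ⟨γ'', -, hγ''⟩ := hd.exists_mem_integralForms_wedgePow_eq_content_smul (le_refl (q + q'))
  rw [wedge_eq_choose_mul_smul_of_wedgePow_eq hd.1 (hd.pos hη) hq hq' le_rfl hγ hγ' hγ'', torusIntegral_smul,
    torusIntegral_domDomCongr_finCongr₃₆, hd.torusIntegral_minimalClass_top hη _ hγ'', mul_comm]
  rfl

/-- **Symplectic presentation: `∫_X γ_q ∧ γ_{q'} = (−1)^g · C(g, q) · R_{q,q'}`** (`q + q' = g`). [cite: Lange2023AbelianVarietiesComplex, §7.3.1 Lemma 7.3.6, §2.5.3 Cor. 2.5.17 (d)] -/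
theorem IsSymplecticEnum.torusIntegral_minimalClass_wedge_minimalClass (h : IsSymplecticEnum Φ e₀ η d) (hη : IsRiemannForm Φ η)
    {q q' : ℕ} (hq : q ≤ g) (hq' : q' ≤ g) (hqq : q + q' = g) (e : Fin (2 * q + 2 * q') ≃ ι)
    {γ : E [⋀^Fin (2 * q)]→L[ℝ] ℂ} {γ' : E [⋀^Fin (2 * q')]→L[ℝ] ℂ}
    (hγ : wedgePow (ofRealForm η) q = ((q.factorial * ∏ i : Fin q, d (Fin.castLE hq i) : ℕ) : ℂ) • γ)
    (hγ' : wedgePow (ofRealForm η) q' = ((q'.factorial * ∏ i : Fin q', d (Fin.castLE hq' i) : ℕ) : ℂ) • γ') :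
    torusIntegral Φ e (γ.wedge γ') = (-1) ^ g * ((g.choose q * ((∏ i, d i) /
        ((∏ i : Fin q, d (Fin.castLE hq i)) * ∏ i : Fin q', d (Fin.castLE hq' i))) : ℕ) : ℂ) :=
  h.isPolarizationType.torusIntegral_minimalClass_wedge_minimalClass hη hq hq' hqq e hγ hγ'

/-- **`g = 2q`: the self-intersection of the middle minimal class, `∫_X γ_q ∧ γ_q = C(2q, q)·∏_{i<q} d_{q+i}/dᵢ`** — the discriminant of the rank-one
middle Hodge lattice `Hdg^q(X, ℤ) = ℤγ_q` of a general polarised torus of dimension `2q` (type `(1, d)` abelian surface: `γ₁² = 2d`; general p.p.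
fourfold: `6`). [cite: Lange2023AbelianVarietiesComplex, §7.3.1 Lemma 7.3.6 and Thm. 7.3.1, §2.5.3 Cor. 2.5.17 (d)] [cite: BenoistDebarre2023SmoothSubvarietiesJacobians, §3 Prop. 3.3] -/
theorem IsPolarizationType.torusIntegral_minimalClass_wedge_self {Φ : (ι → ℝ) ≃L[ℝ] E} (hd : IsPolarizationType Φ η d)
    (hη : IsRiemannForm Φ η) {q : ℕ} (hq : q ≤ g) (hqq : q + q = g) (e : Fin (2 * q + 2 * q) ≃ ι) {γ : E [⋀^Fin (2 * q)]→L[ℝ] ℂ}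
    (hγ : wedgePow (ofRealForm η) q = ((q.factorial * ∏ i : Fin q, d (Fin.castLE hq i) : ℕ) : ℂ) • γ) :
    torusIntegral Φ e (γ.wedge γ) =
      ((g.choose q * ((∏ i, d i) / ((∏ i : Fin q, d (Fin.castLE hq i)) * ∏ i : Fin q, d (Fin.castLE hq i))) : ℕ) : ℂ) := by
  rw [hd.torusIntegral_minimalClass_wedge_minimalClass hη hq hq hqq e hγ hγ]
  have heven : Even g := ⟨q, hqq.symm⟩
  rw [heven.neg_one_pow, one_mul]

/-- **Principal type: `∫_X γ_q ∧ γ_{q'} = (−1)^g · C(g, q)`** (`q + q' = g`) — the divided powers `θ^{[q]}`, `θ^{[g−q]}` of a principal polarisation are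
dual bases of `Hdg^q(X, ℤ)`, `Hdg^{g−q}(X, ℤ)` up to the binomial coefficient; `g = 2q`: `∫_X θ^{[q]} ∧ θ^{[q]} = C(2q, q)`.
[cite: Lange2023AbelianVarietiesComplex, §7.3.1 Lemma 7.3.6, §2.5.3 Cor. 2.5.17 (d), §2.1.1] [cite: Brown1982CohomologyGroups, Ch. V §6] -/
theorem IsPolarizationType.torusIntegral_minimalClass_wedge_minimalClass_of_type_one {Φ : (ι → ℝ) ≃L[ℝ] E}
    (hd : IsPolarizationType Φ η d) (hη : IsRiemannForm Φ η) (h1 : ∀ i, d i = 1) {q q' : ℕ} (hq : q ≤ g) (hq' : q' ≤ g)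
    (hqq : q + q' = g) (e : Fin (2 * q + 2 * q') ≃ ι) {γ : E [⋀^Fin (2 * q)]→L[ℝ] ℂ} {γ' : E [⋀^Fin (2 * q')]→L[ℝ] ℂ}
    (hγ : wedgePow (ofRealForm η) q = (q.factorial : ℂ) • γ) (hγ' : wedgePow (ofRealForm η) q' = (q'.factorial : ℂ) • γ') :
    torusIntegral Φ e (γ.wedge γ') = (-1) ^ g * (g.choose q : ℂ) := by
  have hN : ∀ {k : ℕ} (hk : k ≤ g), ((k.factorial * ∏ i : Fin k, d (Fin.castLE hk i) : ℕ) : ℂ) = (k.factorial : ℂ) := fun hk ↦ by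
    simp [h1]
  rw [hd.torusIntegral_minimalClass_wedge_minimalClass hη hq hq' hqq e (by rw [hN, hγ]) (by rw [hN, hγ'])]
  simp [h1]

/-! ## §5 Basis-free forms of §3 (any presentation; THE type; principal polarisations) -/

/-- **`[Hdg^{j+q}(X, ℤ) : θ^{∧j} ∧ Hdg^q(X, ℤ)] = ((j+q)!/q!)·d_{q+1}⋯d_{q+j}` on any presentation of a polarised torus of type `d`** with
`dim_ℚ B^q = dim_ℚ B^{j+q} = 1` (`j + q ≤ g`). [cite: Lange2023AbelianVarietiesComplex, §7.3.2 (1) (PDF p. 338), §7.3.1 Thm. 7.3.1, §1.5.1] [cite: BenoistDebarre2023SmoothSubvarietiesJacobians, §3 proof of Thm. 3.7 (p. 7)] -/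
theorem IsPolarizationType.relIndex_map_wedgePow_wedge_integralHodgeClasses {Φ : (ι → ℝ) ≃L[ℝ] E} (hd : IsPolarizationType Φ η d)
    (hη : IsRiemannForm Φ η) {j q : ℕ} (hq : q ≤ g) (hjq : j + q ≤ g) (hBq : finrank ℚ (hodgeClasses Φ q) = 1)
    (hBjq : finrank ℚ (hodgeClasses Φ (j + q)) = 1) :
    ((integralHodgeClasses Φ q).map (AddMonoidHom.mk'
        (fun x : E [⋀^Fin (2 * q)]→L[ℝ] ℂ ↦ (wedgePow (ofRealForm η) j).wedge x)
        (ContinuousAlternatingMap.wedge_add_right _))).relIndex (integralHodgeClassesIn Φ (2 * j + 2 * q) (j + q)) =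
      ((j + q).factorial * ∏ i : Fin (j + q), d (Fin.castLE hjq i)) / (q.factorial * ∏ i : Fin q, d (Fin.castLE hq i)) := by
  obtain ⟨Φ', hΛ, hs⟩ := hd.exists_isSymplecticEnum Φ
  rw [← hodgeClasses_eq_of_range_latticeVec_eq hΛ q] at hBq
  rw [← hodgeClasses_eq_of_range_latticeVec_eq hΛ (j + q)] at hBjq
  rw [← integralHodgeClasses_eq_of_range_latticeVec_eq hΛ q, integralHodgeClassesIn,
    ← integralForms_eq_of_range_latticeVec_eq hΛ (2 * j + 2 * q)]
  exact hs.relIndex_map_wedgePow_wedge_integralHodgeClasses Φ' (hη.of_range_latticeVec_subset hΛ.le) hq hjq hBq hBjq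

/-- **THE type, general polarised torus (`Sp ⊆ Hg(X)`): `[Hdg^{j+q}(X, ℤ) : θ^{∧j} ∧ Hdg^q(X, ℤ)] = ((j+q)!/q!)·d_{q+1}⋯d_{q+j}`** for every
`j + q ≤ g = dim X`. [cite: Lange2023AbelianVarietiesComplex, §7.3.2 (1) (PDF p. 338), §7.3.1 Prop. 7.3.3, §1.5.1] [cite: BenoistDebarre2023SmoothSubvarietiesJacobians, §3 proof of Thm. 3.7 (p. 7)] -/
theorem IsRiemannForm.relIndex_map_wedgePow_wedge_integralHodgeClasses_of_spGroup_le [FiniteDimensional ℂ E] {Φ : (ι → ℝ) ≃L[ℝ] E}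
    (hη : IsRiemannForm Φ η) (hHg : spGroup Φ η ≤ hodgeGroup Φ) {j q : ℕ} (hq : q ≤ Fintype.card ι / 2)
    (hjq : j + q ≤ Fintype.card ι / 2) :
    ((integralHodgeClasses Φ q).map (AddMonoidHom.mk'
        (fun x : E [⋀^Fin (2 * q)]→L[ℝ] ℂ ↦ (wedgePow (ofRealForm η) j).wedge x)
        (ContinuousAlternatingMap.wedge_add_right _))).relIndex (integralHodgeClassesIn Φ (2 * j + 2 * q) (j + q)) =
      ((j + q).factorial * ∏ i : Fin (j + q), hη.polarizationType (Fin.castLE hjq i)) /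
        (q.factorial * ∏ i : Fin q, hη.polarizationType (Fin.castLE hq i)) := by
  have hcard := card_eq_two_mul_finrank Φ (E := E)
  have hq' : q ≤ finrank ℂ E := by omega
  have hjq' : j + q ≤ finrank ℂ E := by omega
  exact hη.isPolarizationType_polarizationType.relIndex_map_wedgePow_wedge_integralHodgeClasses hη hq hjq
    (hη.finrank_hodgeClasses_eq_one_of_spGroup_le hHg hq') (hη.finrank_hodgeClasses_eq_one_of_spGroup_le hHg hjq')

/-- **Principally polarised torus with `Sp ⊆ Hg(X)`: `[Hdg^{j+q}(X, ℤ) : θ^{∧j} ∧ Hdg^q(X, ℤ)] = (j+q)!/q!`** for every `j + q ≤ g` (`2(j+q) ≤ |ι|`).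
[cite: BenoistDebarre2023SmoothSubvarietiesJacobians, §3 proof of Thm. 3.7 (p. 7)] [cite: Lange2023AbelianVarietiesComplex, §7.3.2 (1) (PDF p. 338), §2.1.1] -/
theorem IsPrincipalPolarization.relIndex_map_wedgePow_wedge_integralHodgeClasses_of_spGroup_le [FiniteDimensional ℂ E]
    {Φ : (ι → ℝ) ≃L[ℝ] E} (hp : IsPrincipalPolarization Φ η) (hHg : spGroup Φ η ≤ hodgeGroup Φ) {j q : ℕ}
    (hjq : 2 * (j + q) ≤ Fintype.card ι) :
    ((integralHodgeClasses Φ q).map (AddMonoidHom.mk'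
        (fun x : E [⋀^Fin (2 * q)]→L[ℝ] ℂ ↦ (wedgePow (ofRealForm η) j).wedge x)
        (ContinuousAlternatingMap.wedge_add_right _))).relIndex (integralHodgeClassesIn Φ (2 * j + 2 * q) (j + q)) =
      (j + q).factorial / q.factorial := by
  have hcard := card_eq_two_mul_finrank Φ (E := E)
  obtain ⟨g, d', hd', h1⟩ := hp.exists_type_eq_one
  have hg := hd'.card_eq
  have hqg : q ≤ g := by omega
  have hjqg : j + q ≤ g := by omega
  have hq' : q ≤ finrank ℂ E := by omega
  have hjq' : j + q ≤ finrank ℂ E := by omega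
  rw [hd'.relIndex_map_wedgePow_wedge_integralHodgeClasses hp.isRiemannForm hqg hjqg
    (hp.isRiemannForm.finrank_hodgeClasses_eq_one_of_spGroup_le hHg hq')
    (hp.isRiemannForm.finrank_hodgeClasses_eq_one_of_spGroup_le hHg hjq')]
  simp [h1]

end MinimalClassesRing

end Literature.Geometry.Kaehler.ComplexTorus
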